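import Literature.Probability.LatticeModels.BubbleScaleSequence
import Literature.Probability.LatticeModels.RegularScales
import Literature.Probability.LatticeModels.ImprovedTreeDiagramBoundSum
import HarnessLib

/-!
# Sphere and annulus sums of a two-point function under the infrared bound (the estimates of the proof of Lemma 4.4 / 6.2 of Aizenman–Duminil-Copin 2021)

Topic `Literature/Probability/LatticeModels`. In the proof of the intersection property,
M. Aizenman, H. Duminil-Copin, Ann. of Math. **194** (2021), arXiv:1912.07973
[AizenmanDuminilCopinAnnals2021], Lemma 4.4 (pp. 11–12; Lemma 6.2, p. 21: "the bounds in (4.7) and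
(4.8) follow readily from the Infrared Bound (5.1)"), the probabilities of the four bad events and
the two moments of `|𝓜|` are reduced to sums of products of two-point functions over spheres
`∂Λ_n` and annuli `Ann(m,M)` of `ℤ⁴`, which are then estimated by the infrared bound
`⟨σ₀σ_x⟩ ≤ C/|x|²` (eq. (4.1)/(5.1)): "`∑_{v ∈ ∂Λ_n, w ∈ ∂Λ_{ℓ_k}} ⟨σ₀σ_v⟩⟨σ_vσ_w⟩ … ≤ C₆ n³ ℓ_k³ n^{-4}`",
"`∑_{v ∈ ∂Λ_n, w ∈ ∂Λ_m} ⟨σ_vσ_w⟩² ≤ C₈ n^{-ε}`" (p. 12), and "`E[|𝓜|] ≥ c₁(B_M − B_{m−1})`",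
"`E[|𝓜|²] ≤ c₃(B_M − B_{m−1}) B_{2M}`" (p. 21).

This file proves these elementary estimates for an arbitrary function `S : ℤ⁴ → ℝ` with
`0 ≤ S` and `S(x) ≤ A/‖x‖²_∞` off the origin (sup norm `Site.supNorm`; `sphere 4 r = ∂Λ_r`,
`ann 4 m M = Ann(m, M)`, `bubbleDiagram S L = B_L = ∑_{Λ_L} S²`), with explicit constants
(`|∂Λ_r| ≤ 216 r³`, `card_sphere_four_le`):

* `sum_sphere_apply_le` — `∑_{∂Λ_m} S ≤ 216 A m`;
* `sum_sphere_sphere_mul_le` — `∑_{v ∈ ∂Λ_r} ∑_{w ∈ ∂Λ_s} S(v) S(w − v) ≤ 4·216² A² s³/r` for `2s ≤ r`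
  (the `F₁`/`F₄` sums);
* `sum_sphere_sphere_sq_le_of_two_mul_le` — `∑_{v ∈ ∂Λ_r} ∑_{w ∈ ∂Λ_s} S(w − v)² ≤ 16·216² A² r³/s` for `2r ≤ s`
  (the `F₂`/`F₃` sums);
* `sum_ann_sq_eq` — `∑_{Ann(m,M)} S² = B_M − B_{m−1}`; `sum_ann_sq_shift_le` —
  `∑_{w ∈ Ann(m,M)} S(w − v)² ≤ B_{2M}` for `‖v‖ ≤ M`; `sum_ann_ann_sq_le` —
  `∑∑_{v,w ∈ Ann(m,M)} (S(v)S(w−v) + S(w)S(v−w))² ≤ 4 (B_M − B_{m−1}) B_{2M}` (the second moment).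

No named fact is introduced; everything is proved.

## References

* M. Aizenman, H. Duminil-Copin, Ann. of Math. 194 (2021), arXiv:1912.07973, §4.2, proof of Lemma 4.4,
  displays (4.7)–(4.8) and the bounds on `P[F₁]`, `P[F₂]` (pp. 11–12); §6.1, proof of Lemma 6.2 (p. 21)
  [AizenmanDuminilCopinAnnals2021].
-/

noncomputable section

open Finset

namespace Literature.Probability.LatticeModels

variable {S : Site 4 → ℝ} {A : ℝ}

/-! ### One sphere -/

/-- The constant of an infrared bound dominating a non-negative function is non-negative. [folklore] -/
theorem irBound_nonneg (h0 : ∀ x, 0 ≤ S x)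
    (hIR : ∀ x : Site 4, x ≠ 0 → S x ≤ A / (Site.supNorm x : ℝ) ^ 2) : 0 ≤ A := by
  have hx0 : (Pi.single 0 1 : Site 4) ≠ 0 := by
    intro h
    have := congr_fun h 0
    simp at this
  have h := hIR _ hx0
  rw [Site.supNorm_single] at h
  simpa using (h0 _).trans h

/-- The triangle inequality for sup norms of differences: `‖v‖ − ‖w‖ ≤ ‖w − v‖` (in `ℝ`).
Duplicate of `supNorm_sub_ge` (`ImprovedTreeDiagramBoundSum`, in the import closure; arguments
swapped); deprecated restatement (dedup-01130, 2026-08-16). [folklore] -/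
@[deprecated supNorm_sub_ge (since := "2026-08-16")]
theorem cast_supNorm_sub_le {d : ℕ} (v w : Site d) :
    (Site.supNorm v : ℝ) - Site.supNorm w ≤ Site.supNorm (w - v) :=
  supNorm_sub_ge w v

/-- `‖w − v‖ ≤ ‖w‖ + ‖v‖` for sup norms. [folklore] -/
theorem supNorm_sub_le_add {d : ℕ} (v w : Site d) : Site.supNorm (w - v) ≤ Site.supNorm w + Site.supNorm v := by
  have h : (Site.supNorm (w - v) : ℝ) ≤ Site.supNorm w + Site.supNorm v := by
    rw [← Site.norm_eq_supNorm, ← Site.norm_eq_supNorm, ← Site.norm_eq_supNorm]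
    exact norm_sub_le w v
  exact_mod_cast h

/-- The distance between two spheres: `‖w − v‖_∞ ≥ r − s` and `≥ s − r` for `‖v‖_∞ = r`, `‖w‖_∞ = s`. [folklore] -/
theorem sub_le_supNorm_sub {d : ℕ} {v w : Site d} {r s : ℕ} (hv : Site.supNorm v = r) (hw : Site.supNorm w = s) :
    r - s ≤ Site.supNorm (w - v) ∧ s - r ≤ Site.supNorm (w - v) := by
  have hn : Site.supNorm (v - w) = Site.supNorm (w - v) := by
    have : ((Site.supNorm (v - w) : ℕ) : ℝ) = Site.supNorm (w - v) := by
      rw [← Site.norm_eq_supNorm, ← Site.norm_eq_supNorm, norm_sub_rev]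
    exact_mod_cast this
  have h1 : (r : ℝ) - s ≤ Site.supNorm (w - v) := by
    have := supNorm_sub_ge w v
    rwa [hv, hw] at this
  have h2 : (s : ℝ) - r ≤ Site.supNorm (w - v) := by
    have := supNorm_sub_ge v w
    rwa [hv, hw, hn] at this
  constructor
  · rcases le_or_gt s r with h | h
    · rw [← Nat.cast_sub h] at h1; exact_mod_cast h1
    · rw [Nat.sub_eq_zero_of_le h.le]; exact Nat.zero_le _
  · rcases le_or_gt r s with h | h
    · rw [← Nat.cast_sub h] at h2; exact_mod_cast h2
    · rw [Nat.sub_eq_zero_of_le h.le]; exact Nat.zero_le _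

/-- Under the infrared bound, `S(x) ≤ A/r²` whenever `‖x‖_∞ ≥ r ≥ 1`. [folklore] -/
theorem apply_le_div_sq_of_le_supNorm (h0 : ∀ x, 0 ≤ S x)
    (hIR : ∀ x : Site 4, x ≠ 0 → S x ≤ A / (Site.supNorm x : ℝ) ^ 2) {r : ℕ} (hr : 1 ≤ r) {x : Site 4}
    (hx : r ≤ Site.supNorm x) : S x ≤ A / (r : ℝ) ^ 2 := by
  have hx0 : x ≠ 0 := by
    intro h
    rw [h, Site.supNorm_eq_zero_iff.2 rfl] at hx
    omega
  have h1 := hIR x hx0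
  have hA : 0 ≤ A := irBound_nonneg h0 hIR
  calc S x ≤ A / (Site.supNorm x : ℝ) ^ 2 := h1
    _ ≤ A / (r : ℝ) ^ 2 := by
        apply div_le_div_of_nonneg_left hA (by positivity)
        have : (r : ℝ) ≤ Site.supNorm x := by exact_mod_cast hx
        exact pow_le_pow_left₀ (by positivity) this 2

/-- **One sphere**: `∑_{∂Λ_m} S ≤ 216 A m` for `m ≥ 1` under the infrared bound. [cite: AizenmanDuminilCopinAnnals2021, arXiv:1912.07973 §4.2, proof of Lemma 4.4 (the counting n³, p. 12)] -/
theorem sum_sphere_apply_le (h0 : ∀ x, 0 ≤ S x)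
    (hIR : ∀ x : Site 4, x ≠ 0 → S x ≤ A / (Site.supNorm x : ℝ) ^ 2) {m : ℕ} (hm : 1 ≤ m) :
    ∑ x ∈ sphere 4 m, S x ≤ 216 * A * m := by
  have hm0 : (0 : ℝ) < m := by exact_mod_cast hm
  have hpt : ∀ x ∈ sphere 4 m, S x ≤ A / (m : ℝ) ^ 2 := fun x hx =>
    apply_le_div_sq_of_le_supNorm h0 hIR hm (mem_sphere.1 hx).ge
  have hA : 0 ≤ A / (m : ℝ) ^ 2 := by
    obtain ⟨x, hx⟩ : (sphere 4 m).Nonempty := by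
      refine ⟨Pi.single 0 (m : ℤ), mem_sphere.2 ?_⟩
      rw [Site.supNorm_single]; simp
    exact (h0 x).trans (hpt x hx)
  calc ∑ x ∈ sphere 4 m, S x ≤ ∑ _x ∈ sphere 4 m, A / (m : ℝ) ^ 2 := Finset.sum_le_sum hpt
    _ = (#(sphere 4 m) : ℝ) * (A / (m : ℝ) ^ 2) := by rw [sum_const, nsmul_eq_mul]
    _ ≤ 216 * (m : ℝ) ^ 3 * (A / (m : ℝ) ^ 2) :=
        mul_le_mul_of_nonneg_right (card_sphere_four_le hm) hA
    _ = 216 * A * m := by field_simp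

/-! ### Two spheres: the `F₁`/`F₄` and `F₂`/`F₃` sums -/

/-- **The `F₁`/`F₄` sums**: `∑_{v ∈ ∂Λ_r} ∑_{w ∈ ∂Λ_s} S(v) S(w − v) ≤ 4·216² A² s³/r` for
`1 ≤ s`, `2s ≤ r`, under the infrared bound ("`∑_{v ∈ ∂Λ_n, w ∈ ∂Λ_{ℓ_k}} … ≤ C₆ n³ℓ_k³ n^{-4} ≤ C₇ ℓ_k^{-ε}`").
[cite: AizenmanDuminilCopinAnnals2021, arXiv:1912.07973 §4.2, proof of Lemma 4.4, bound on P[F₁] (p. 12)] -/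
theorem sum_sphere_sphere_mul_le (h0 : ∀ x, 0 ≤ S x)
    (hIR : ∀ x : Site 4, x ≠ 0 → S x ≤ A / (Site.supNorm x : ℝ) ^ 2) {r s : ℕ} (hs : 1 ≤ s) (hsr : 2 * s ≤ r) :
    ∑ v ∈ sphere 4 r, ∑ w ∈ sphere 4 s, S v * S (w - v) ≤ 4 * 216 ^ 2 * A ^ 2 * (s : ℝ) ^ 3 / r := by
  have hr : 1 ≤ r := by omega
  have hr0 : (0 : ℝ) < r := by exact_mod_cast hr
  have hrs : 1 ≤ r - s := by omega
  have hA : 0 ≤ A := irBound_nonneg h0 hIR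
  -- termwise: `S(v) ≤ A/r²`, `S(w - v) ≤ A/(r-s)² ≤ 4A/r²`
  have hterm : ∀ v ∈ sphere 4 r, ∀ w ∈ sphere 4 s, S v * S (w - v) ≤ A / (r : ℝ) ^ 2 * (4 * A / (r : ℝ) ^ 2) := by
    intro v hv w hw
    have h1 : S v ≤ A / (r : ℝ) ^ 2 := apply_le_div_sq_of_le_supNorm h0 hIR hr (mem_sphere.1 hv).ge
    have h2 : S (w - v) ≤ A / ((r - s : ℕ) : ℝ) ^ 2 :=
      apply_le_div_sq_of_le_supNorm h0 hIR hrs (sub_le_supNorm_sub (mem_sphere.1 hv) (mem_sphere.1 hw)).1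
    have h3 : A / ((r - s : ℕ) : ℝ) ^ 2 ≤ 4 * A / (r : ℝ) ^ 2 := by
      rw [div_le_div_iff₀ (by positivity) (by positivity)]
      have hc : (r : ℝ) ≤ 2 * ((r - s : ℕ) : ℝ) := by
        rw [Nat.cast_sub (by omega)]
        have : (2 * s : ℝ) ≤ r := by exact_mod_cast hsr
        linarith
      have hr' : (0 : ℝ) ≤ r := hr0.le
      calc A * (r : ℝ) ^ 2 ≤ A * (2 * ((r - s : ℕ) : ℝ)) ^ 2 :=
            mul_le_mul_of_nonneg_left (pow_le_pow_left₀ hr' hc 2) hA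
        _ = 4 * A * ((r - s : ℕ) : ℝ) ^ 2 := by ring
    exact mul_le_mul h1 (h2.trans h3) (h0 _) ((h0 v).trans h1)
  have hA2 : 0 ≤ A / (r : ℝ) ^ 2 * (4 * A / (r : ℝ) ^ 2) := by positivity
  calc ∑ v ∈ sphere 4 r, ∑ w ∈ sphere 4 s, S v * S (w - v)
      ≤ ∑ v ∈ sphere 4 r, ∑ _w ∈ sphere 4 s, A / (r : ℝ) ^ 2 * (4 * A / (r : ℝ) ^ 2) :=
        Finset.sum_le_sum fun v hv => Finset.sum_le_sum fun w hw => hterm v hv w hw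
    _ = (#(sphere 4 r) : ℝ) * ((#(sphere 4 s) : ℝ) * (A / (r : ℝ) ^ 2 * (4 * A / (r : ℝ) ^ 2))) := by
        rw [sum_const, nsmul_eq_mul, sum_const, nsmul_eq_mul]
    _ ≤ 216 * (r : ℝ) ^ 3 * (216 * (s : ℝ) ^ 3 * (A / (r : ℝ) ^ 2 * (4 * A / (r : ℝ) ^ 2))) :=
        mul_le_mul (card_sphere_four_le hr) (mul_le_mul_of_nonneg_right (card_sphere_four_le hs) hA2)
          (mul_nonneg (Nat.cast_nonneg _) hA2) (by positivity)
    _ = 4 * 216 ^ 2 * A ^ 2 * (s : ℝ) ^ 3 / r := by field_simp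

/-- **The `F₂`/`F₃` sums**: `∑_{v ∈ ∂Λ_r} ∑_{w ∈ ∂Λ_s} S(w − v)² ≤ 16·216² A² r³/s` for `1 ≤ r`,
`2r ≤ s`, under the infrared bound ("`∑_{v ∈ ∂Λ_n, w ∈ ∂Λ_m} ⟨σ_vσ_w⟩² ≤ C₈ n^{-ε}`").
[cite: AizenmanDuminilCopinAnnals2021, arXiv:1912.07973 §4.2, proof of Lemma 4.4, bound on P[F₂] (p. 12)] -/
theorem sum_sphere_sphere_sq_le_of_two_mul_le (h0 : ∀ x, 0 ≤ S x)
    (hIR : ∀ x : Site 4, x ≠ 0 → S x ≤ A / (Site.supNorm x : ℝ) ^ 2) {r s : ℕ} (hr : 1 ≤ r) (hrs : 2 * r ≤ s) :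
    ∑ v ∈ sphere 4 r, ∑ w ∈ sphere 4 s, S (w - v) ^ 2 ≤ 16 * 216 ^ 2 * A ^ 2 * (r : ℝ) ^ 3 / s := by
  have hs : 1 ≤ s := by omega
  have hs0 : (0 : ℝ) < s := by exact_mod_cast hs
  have hsr : 1 ≤ s - r := by omega
  have hterm : ∀ v ∈ sphere 4 r, ∀ w ∈ sphere 4 s, S (w - v) ^ 2 ≤ (4 * A / (s : ℝ) ^ 2) ^ 2 := by
    intro v hv w hw
    have hge : s - r ≤ Site.supNorm (w - v) := (sub_le_supNorm_sub (mem_sphere.1 hv) (mem_sphere.1 hw)).2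
    have h2 : S (w - v) ≤ A / ((s - r : ℕ) : ℝ) ^ 2 := apply_le_div_sq_of_le_supNorm h0 hIR hsr hge
    have hA : 0 ≤ A := irBound_nonneg h0 hIR
    have h3 : A / ((s - r : ℕ) : ℝ) ^ 2 ≤ 4 * A / (s : ℝ) ^ 2 := by
      rw [div_le_div_iff₀ (by positivity) (by positivity)]
      have hc : (s : ℝ) ≤ 2 * ((s - r : ℕ) : ℝ) := by
        rw [Nat.cast_sub (by omega)]
        have : (2 * r : ℝ) ≤ s := by exact_mod_cast hrs
        linarith
      calc A * (s : ℝ) ^ 2 ≤ A * (2 * ((s - r : ℕ) : ℝ)) ^ 2 :=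
            mul_le_mul_of_nonneg_left (pow_le_pow_left₀ hs0.le hc 2) hA
        _ = 4 * A * ((s - r : ℕ) : ℝ) ^ 2 := by ring
    exact pow_le_pow_left₀ (h0 _) (h2.trans h3) 2
  calc ∑ v ∈ sphere 4 r, ∑ w ∈ sphere 4 s, S (w - v) ^ 2
      ≤ ∑ v ∈ sphere 4 r, ∑ _w ∈ sphere 4 s, (4 * A / (s : ℝ) ^ 2) ^ 2 :=
        Finset.sum_le_sum fun v hv => Finset.sum_le_sum fun w hw => hterm v hv w hw
    _ = (#(sphere 4 r) : ℝ) * ((#(sphere 4 s) : ℝ) * (4 * A / (s : ℝ) ^ 2) ^ 2) := by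
        rw [sum_const, nsmul_eq_mul, sum_const, nsmul_eq_mul]
    _ ≤ 216 * (r : ℝ) ^ 3 * (216 * (s : ℝ) ^ 3 * (4 * A / (s : ℝ) ^ 2) ^ 2) :=
        mul_le_mul (card_sphere_four_le hr) (mul_le_mul_of_nonneg_right (card_sphere_four_le hs)
          (sq_nonneg _)) (mul_nonneg (Nat.cast_nonneg _) (sq_nonneg _)) (by positivity)
    _ = 16 * 216 ^ 2 * A ^ 2 * (r : ℝ) ^ 3 / s := by field_simp; ring

/-! ### Annuli: the two moments -/

/-- `Ann(m, M) = Λ_M ∖ Λ_{m−1}` for `m ≥ 1`. [folklore] -/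
theorem ann_eq_sdiff {m M : ℕ} (hm : 1 ≤ m) : ann 4 m M = box 4 M \ box 4 (m - 1) := by
  ext x
  rw [mem_ann, Finset.mem_sdiff, mem_box_iff_supNorm_le, mem_box_iff_supNorm_le]
  omega

/-- **The first moment's sum**: `∑_{Ann(m,M)} S² = B_M − B_{m−1}` for `1 ≤ m ≤ M + 1`
("`E[|𝓜|] ≥ c₁ (B_M(β) − B_{m−1}(β))`"). [cite: AizenmanDuminilCopinAnnals2021, arXiv:1912.07973 §6.1, proof of Lemma 6.2, first display (p. 21)] -/
theorem sum_ann_sq_eq {m M : ℕ} (hm : 1 ≤ m) (hmM : m ≤ M + 1) :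
    ∑ x ∈ ann 4 m M, S x ^ 2 = bubbleDiagram S (M : ℕ) - bubbleDiagram S ((m - 1 : ℕ) : ℝ) := by
  rw [ann_eq_sdiff hm, bubbleDiagram_sub_nat S (by omega : m - 1 ≤ M)]

/-- A shifted annulus sum of squares: `∑_{w ∈ Ann(m,M)} S(w − v)² ≤ B_{2M}` for `‖v‖_∞ ≤ M`
(`w − v ∈ Λ_{2M}`). [cite: AizenmanDuminilCopinAnnals2021, arXiv:1912.07973 §6.1, proof of Lemma 6.2, second display (the factor B_{2M}, p. 21)] -/
theorem sum_ann_sq_shift_le (S : Site 4 → ℝ) {m M : ℕ} {v : Site 4} (hv : Site.supNorm v ≤ M) :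
    ∑ w ∈ ann 4 m M, S (w - v) ^ 2 ≤ bubbleDiagram S ((2 * M : ℕ) : ℝ) := by
  rw [bubbleDiagram_natCast]
  calc ∑ w ∈ ann 4 m M, S (w - v) ^ 2
      = ∑ z ∈ (ann 4 m M).image (fun w => w - v), S z ^ 2 :=
        (Finset.sum_image (s := ann 4 m M) (g := fun w => w - v) (f := fun z => S z ^ 2)
          fun w _ w' _ h => sub_left_injective h).symm
    _ ≤ ∑ z ∈ box 4 (2 * M), S z ^ 2 := by
        refine Finset.sum_le_sum_of_subset_of_nonneg ?_ fun _ _ _ => sq_nonneg _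
        intro z hz
        rw [Finset.mem_image] at hz
        obtain ⟨w, hw, rfl⟩ := hz
        rw [mem_box_iff_supNorm_le]
        have hwM : Site.supNorm w ≤ M := (mem_ann.1 hw).2
        have h := supNorm_sub_le_add v w
        omega

/-- **The second moment's sum**: `∑∑_{v,w ∈ Ann(m,M)} (S(v)S(w−v) + S(w)S(v−w))² ≤ 4 (B_M − B_{m−1}) B_{2M}`
for `1 ≤ m ≤ M + 1` ("`E[|𝓜|²] ≤ c₃ (B_M − B_{m−1}) B_{2M}`"; `(p+q)² ≤ 2p² + 2q²` and the previous
two sums). [cite: AizenmanDuminilCopinAnnals2021, arXiv:1912.07973 §6.1, proof of Lemma 6.2, second display (p. 21)] -/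
theorem sum_ann_ann_sq_le (S : Site 4 → ℝ) {m M : ℕ} (hm : 1 ≤ m) (hmM : m ≤ M + 1) :
    ∑ v ∈ ann 4 m M, ∑ w ∈ ann 4 m M, (S v * S (w - v) + S w * S (v - w)) ^ 2 ≤
      4 * (bubbleDiagram S (M : ℕ) - bubbleDiagram S ((m - 1 : ℕ) : ℝ)) * bubbleDiagram S ((2 * M : ℕ) : ℝ) := by
  set BA := bubbleDiagram S (M : ℕ) - bubbleDiagram S ((m - 1 : ℕ) : ℝ) with hBA
  set B2 := bubbleDiagram S ((2 * M : ℕ) : ℝ) with hB2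
  have hvM : ∀ v ∈ ann 4 m M, Site.supNorm v ≤ M := fun v hv => (mem_ann.1 hv).2
  -- the two halves
  have h1 : ∑ v ∈ ann 4 m M, ∑ w ∈ ann 4 m M, (S v * S (w - v)) ^ 2 ≤ BA * B2 := by
    calc ∑ v ∈ ann 4 m M, ∑ w ∈ ann 4 m M, (S v * S (w - v)) ^ 2
        = ∑ v ∈ ann 4 m M, S v ^ 2 * ∑ w ∈ ann 4 m M, S (w - v) ^ 2 := by
          refine Finset.sum_congr rfl fun v _ => ?_
          rw [Finset.mul_sum]
          refine Finset.sum_congr rfl fun w _ => ?_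
          ring
      _ ≤ ∑ v ∈ ann 4 m M, S v ^ 2 * B2 :=
          Finset.sum_le_sum fun v hv => mul_le_mul_of_nonneg_left (sum_ann_sq_shift_le S (hvM v hv)) (sq_nonneg _)
      _ = BA * B2 := by rw [← Finset.sum_mul, sum_ann_sq_eq hm hmM]
  have h2 : ∑ v ∈ ann 4 m M, ∑ w ∈ ann 4 m M, (S w * S (v - w)) ^ 2 ≤ BA * B2 := by
    rw [Finset.sum_comm]
    calc ∑ w ∈ ann 4 m M, ∑ v ∈ ann 4 m M, (S w * S (v - w)) ^ 2
        = ∑ w ∈ ann 4 m M, S w ^ 2 * ∑ v ∈ ann 4 m M, S (v - w) ^ 2 := by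
          refine Finset.sum_congr rfl fun w _ => ?_
          rw [Finset.mul_sum]
          refine Finset.sum_congr rfl fun v _ => ?_
          ring
      _ ≤ ∑ w ∈ ann 4 m M, S w ^ 2 * B2 :=
          Finset.sum_le_sum fun w hw => mul_le_mul_of_nonneg_left (sum_ann_sq_shift_le S (hvM w hw)) (sq_nonneg _)
      _ = BA * B2 := by rw [← Finset.sum_mul, sum_ann_sq_eq hm hmM]
  calc ∑ v ∈ ann 4 m M, ∑ w ∈ ann 4 m M, (S v * S (w - v) + S w * S (v - w)) ^ 2
      ≤ ∑ v ∈ ann 4 m M, ∑ w ∈ ann 4 m M, (2 * (S v * S (w - v)) ^ 2 + 2 * (S w * S (v - w)) ^ 2) :=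
        Finset.sum_le_sum fun v _ => Finset.sum_le_sum fun w _ => by
          nlinarith [sq_nonneg (S v * S (w - v) - S w * S (v - w))]
    _ = 2 * ∑ v ∈ ann 4 m M, ∑ w ∈ ann 4 m M, (S v * S (w - v)) ^ 2 +
          2 * ∑ v ∈ ann 4 m M, ∑ w ∈ ann 4 m M, (S w * S (v - w)) ^ 2 := by
        rw [Finset.mul_sum, Finset.mul_sum, ← Finset.sum_add_distrib]
        refine Finset.sum_congr rfl fun v _ => ?_
        rw [Finset.mul_sum, Finset.mul_sum, ← Finset.sum_add_distrib]
    _ ≤ 2 * (BA * B2) + 2 * (BA * B2) := by linarith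
    _ = 4 * BA * B2 := by ring

end Literature.Probability.LatticeModels
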